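import Summits.RiemannHypothesis.RiemannHypothesis.Theorems.PfPersistenceEdgeLawDini
import Summits.RiemannHypothesis.RiemannHypothesis.Theorems.PfPersistenceEdgeLawDialSpace
import HarnessLib

/-!
# The prime-entry corner of the window bottom (the kink law, Dini form) — RH-free helper

pub-rhpf (mechanism / rigidity campaign; **no RH claims**), theory-1 gen 5, THEORY-EDGE-5 §2.4.

The campaign's KINK LAW (PF.md §5.8/§14.2, Galerkin level, by finite-dimensional Hellmann–Feynman;
DATA THEORY-2.md §3): at a window `a = ½ log n` at which the prime-power lag `log n` ENTERS the
window, the Galerkin bottom `ε₁^N` has a concave corner `ε₁^N'(a⁻) − ε₁^N'(a⁺) = 4 Λ(n) n^{-1/2} θ_N²`.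

This file proves the SCHEMA-LEVEL form of that law for EVERY windowed form `W : WindowForm`
(`PfPersistenceEdgeLawUniversal`), from the Dini edge law (`PfPersistenceEdgeLawDini`) and the
kinematics of an entering lag, with the two regularity inputs as NAMED HYPOTHESES:

* §1 kinematics [folklore]: for `u ∈ L²` vanishing on `|x| ≥ a`, the increment of the dilate
  `weilDilate η u` at the lag `2a` (the support diameter) is the constant `2‖u‖²` for `η ≥ 0`
  (compression: the lag stays outside), so its RIGHT `η`-derivative at `0` is `0`
  (`hasDerivWithinAt_weilIncrement_weilDilate_diam_Ioi`); if `t ↦ D_t(u)` has a LEFT derivative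
  `D'` at `t = 2a`, its LEFT `η`-derivative at `0` is `2a·D'` (expansion: the lag moves inside;
  `hasDerivWithinAt_weilIncrement_weilDilate_diam_Iio`).
* §2 the corner over `WindowForm` [folklore: Kato VII §6.5 one-sided derivatives + the kinematics]:
  if the profile of a ground state `u` of a dilation-covariant window `a` MINUS `c·D_{2a}(u_η)` is
  differentiable at `0` with derivative `Vr` (the "regular part": every other term of the form),
  then `D₋ε(a) ≥ −Vr/a` and `D⁺ε(a) ≤ −Vr/a − 2c·D'` (`WindowForm.corner_of_entering_lag`); with
  one-sided derivatives `e₋, e₊` of the bottom, `e₋ − e₊ ≥ 2c·D'` (`WindowForm.corner_gap`); and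
  `c·D' > 0` forces a corner (`WindowForm.not_differentiableAt_energy_of_entering_lag`).
* §3 instances: every real weight table (`tableWindowForm`, the coefficient `c` free — for the
  table `w` and `2a = log n₀` the natural choice is `c = w n₀`), and ζ (`weilWindowForm`).

For a state continuous up to the edges with edge values `θ₊ = u(a⁻)`, `θ₋ = u(−a⁺)` one has
`D' = 2 θ₊θ₋` [DERIVED, not proved here], which gives the campaign's constant `4 w(n₀) θ₊θ₋`.
Nothing here reads the arithmetic of the weights: the corner EXISTS for every windowed form with an
atom at the entering lag; only its SIZE `2c·D'` carries the weight. No RH content.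

References: T. Kato, Perturbation Theory for Linear Operators (1966), II §6.4, VII §4.6, §6.5
(one-sided derivatives of eigenvalues; forms with varying domain); E. Bombieri, Remarks on Weil's
quadratic functional in the theory of prime numbers I, Rend. Mat. Acc. Lincei (9) 11 (2000)
183–233, §4 (the dilation); the kink law at the Galerkin level: campaign notes PF.md §14.2 (DATA).
-/

set_option linter.dupNamespace false

noncomputable section

open MeasureTheory Set Filter
open scoped Topology

namespace Summit.RiemannHypothesis.RiemannHypothesis.Theorems.PfPersistence

open Literature.NumberTheory.LFunctions
open Summit.RiemannHypothesis.RiemannHypothesis.Theorems.WeilWindowFlowWindowLipschitz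

/-! ## §1 Kinematics of an entering lag -/

/-- Compression keeps the diameter lag outside: for `u ∈ L²` vanishing on `|x| ≥ a` (`a ≥ 0`) and
`η ≥ 0`, `D_{2a}(u_η) = D_{(1+η)2a}(u) = 2‖u‖²`. [folklore] -/
theorem weilIncrement_weilDilate_diam_of_nonneg {u : ℝ → ℂ} {a η : ℝ} (hu : MemLp u 2)
    (hus : ∀ x, a ≤ |x| → u x = 0) (ha : 0 ≤ a) (hη : 0 ≤ η) :
    weilIncrement (weilDilate η u) (2 * a) = 2 * ∫ x, ‖u x‖ ^ 2 := by
  rw [weilIncrement_weilDilate u (by linarith) (2 * a)]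
  exact stub_localizedCut_weilIncrement_eq_two_mul hu hus (by nlinarith)

/-- The RIGHT `η`-derivative at `0` of the diameter increment along the dilation orbit is `0`.
[folklore] -/
theorem hasDerivWithinAt_weilIncrement_weilDilate_diam_Ioi {u : ℝ → ℂ} {a : ℝ} (hu : MemLp u 2)
    (hus : ∀ x, a ≤ |x| → u x = 0) (ha : 0 ≤ a) :
    HasDerivWithinAt (fun η : ℝ ↦ weilIncrement (weilDilate η u) (2 * a)) 0 (Ioi 0) 0 := by
  refine (hasDerivWithinAt_const (0 : ℝ) (Ioi (0 : ℝ)) (2 * ∫ x, ‖u x‖ ^ 2)).congr_of_eventuallyEq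
    ?_ ?_
  · filter_upwards [self_mem_nhdsWithin] with η hη
    exact weilIncrement_weilDilate_diam_of_nonneg hu hus ha (le_of_lt hη)
  · exact weilIncrement_weilDilate_diam_of_nonneg hu hus ha le_rfl

/-- The LEFT `η`-derivative at `0` of the diameter increment along the dilation orbit is `2a·D'`,
where `D'` is the left derivative of `t ↦ D_t(u)` at the diameter `t = 2a` (`a > 0`; chain rule on
`D_{2a}(u_η) = D_{(1+η)2a}(u)`, `η ↦ (1+η)2a` maps `η < 0` into `t < 2a`). [folklore] -/
theorem hasDerivWithinAt_weilIncrement_weilDilate_diam_Iio {u : ℝ → ℂ} {a D' : ℝ} (ha : 0 < a)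
    (hD : HasDerivWithinAt (weilIncrement u) D' (Iio (2 * a)) (2 * a)) :
    HasDerivWithinAt (fun η : ℝ ↦ weilIncrement (weilDilate η u) (2 * a)) (2 * a * D') (Iio 0) 0 := by
  have hlin : HasDerivWithinAt (fun η : ℝ ↦ (1 + η) * (2 * a)) (2 * a) (Iio 0) 0 := by
    have h : HasDerivAt (fun η : ℝ ↦ (1 + η) * (2 * a)) (1 * (2 * a)) 0 :=
      ((hasDerivAt_id (0 : ℝ)).const_add 1).mul_const (2 * a)
    rw [one_mul] at h
    exact h.hasDerivWithinAt
  have hmaps : MapsTo (fun η : ℝ ↦ (1 + η) * (2 * a)) (Iio 0) (Iio (2 * a)) := by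
    intro η hη
    simp only [mem_Iio] at hη ⊢
    nlinarith
  have hcomp : HasDerivWithinAt (weilIncrement u ∘ fun η : ℝ ↦ (1 + η) * (2 * a)) (D' * (2 * a))
      (Iio 0) 0 :=
    hD.comp_of_eq (0 : ℝ) hlin hmaps (by simp)
  have hcomp' : HasDerivWithinAt (weilIncrement u ∘ fun η : ℝ ↦ (1 + η) * (2 * a)) (2 * a * D')
      (Iio 0) 0 := by
    rw [mul_comm (2 * a) D']
    exact hcomp
  refine hcomp'.congr_of_eventuallyEq ?_ ?_
  · have h1 : Ioi (-1 : ℝ) ∈ 𝓝[Iio 0] (0 : ℝ) :=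
      mem_nhdsWithin_of_mem_nhds (Ioi_mem_nhds (by norm_num))
    filter_upwards [h1] with η hη
    exact weilIncrement_weilDilate u hη (2 * a)
  · simp only [Function.comp]
    exact weilIncrement_weilDilate u (by norm_num) (2 * a)

/-! ## §2 The corner over the interface `WindowForm` -/

namespace WindowForm

variable {W : WindowForm}

/-- One-sided profile derivatives at an entering lag: if the profile MINUS `c · D_{2a}(u_η)` (the
regular part) has derivative `Vr` at `0`, the profile has RIGHT derivative `Vr` and LEFT derivative
`Vr + c·(2a·D')` at `0`. [folklore] -/
theorem hasDerivWithinAt_profile_of_entering_lag {a : ℝ} {u : ℝ → ℂ} (ha : 0 < a)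
    (hu2 : MemLp u 2) (hus : ∀ x, a ≤ |x| → u x = 0) {c Vr D' : ℝ}
    (hR : HasDerivAt (fun η ↦ W.profile u η - c * weilIncrement (weilDilate η u) (2 * a)) Vr 0)
    (hD : HasDerivWithinAt (weilIncrement u) D' (Iio (2 * a)) (2 * a)) :
    HasDerivWithinAt (W.profile u) Vr (Ioi 0) 0 ∧
      HasDerivWithinAt (W.profile u) (Vr + c * (2 * a * D')) (Iio 0) 0 := by
  constructor
  · have h := hR.hasDerivWithinAt.add
      ((hasDerivWithinAt_weilIncrement_weilDilate_diam_Ioi hu2 hus ha.le).const_mul c)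
    rw [mul_zero, add_zero] at h
    exact h.congr_of_eventuallyEq
      (Eventually.of_forall fun η ↦ by simp only [Pi.add_apply, sub_add_cancel])
      (by simp only [Pi.add_apply, sub_add_cancel])
  · have h := hR.hasDerivWithinAt.add
      ((hasDerivWithinAt_weilIncrement_weilDilate_diam_Iio ha hD).const_mul c)
    exact h.congr_of_eventuallyEq
      (Eventually.of_forall fun η ↦ by simp only [Pi.add_apply, sub_add_cancel])
      (by simp only [Pi.add_apply, sub_add_cancel])

/-- **THE CORNER AT AN ENTERING LAG (Dini form), for every windowed form.** For a ground state `u`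
(`∈ L²`, vanishing on `|x| ≥ a`) of a dilation-covariant window `a > 0` whose profile minus
`c·D_{2a}(u_η)` has derivative `Vr` at `0`, and whose increment has left derivative `D'` at the
diameter: every left slope of the bottom near `a` exceeds `−Vr/a` and every right slope lies below
`−Vr/a − 2c·D'` (up to any margin). [folklore: Kato VII §6.5 + PF §14.2 (the kink law, Galerkin)] -/
theorem corner_of_entering_lag {a : ℝ} {u : ℝ → ℂ} (ha : 0 < a) (hcov : W.DilationCovariantAt a)
    (hu : W.IsGround a u) (hu2 : MemLp u 2) (hus : ∀ x, a ≤ |x| → u x = 0) {c Vr D' : ℝ}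
    (hR : HasDerivAt (fun η ↦ W.profile u η - c * weilIncrement (weilDilate η u) (2 * a)) Vr 0)
    (hD : HasDerivWithinAt (weilIncrement u) D' (Iio (2 * a)) (2 * a)) :
    (∀ s : ℝ, s < -Vr / a → ∀ᶠ b in 𝓝[<] a, s < slope W.energy a b) ∧
      (∀ s : ℝ, -Vr / a - 2 * c * D' < s → ∀ᶠ b in 𝓝[>] a, slope W.energy a b < s) := by
  obtain ⟨hP, hM⟩ := hasDerivWithinAt_profile_of_entering_lag ha hu2 hus hR hD
  refine ⟨fun s hs ↦ lt_slope_energy_eventually_left ha hcov hu hP hs, fun s hs ↦ ?_⟩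
  refine slope_energy_lt_eventually_right ha hcov hu hM ?_
  have e : -(Vr + c * (2 * a * D')) / a = -Vr / a - 2 * c * D' := by
    field_simp
    ring
  rw [e]
  exact hs

/-- **The corner gap.** With one-sided derivatives `e₋` (left) and `e₊` (right) of the bottom at the
entering window: `e₋ − e₊ ≥ 2c·D'`. [folklore: Kato VII §6.5 + PF §14.2] -/
theorem corner_gap {a : ℝ} {u : ℝ → ℂ} (ha : 0 < a) (hcov : W.DilationCovariantAt a)
    (hu : W.IsGround a u) (hu2 : MemLp u 2) (hus : ∀ x, a ≤ |x| → u x = 0) {c Vr D' : ℝ}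
    (hR : HasDerivAt (fun η ↦ W.profile u η - c * weilIncrement (weilDilate η u) (2 * a)) Vr 0)
    (hD : HasDerivWithinAt (weilIncrement u) D' (Iio (2 * a)) (2 * a)) {em ep : ℝ}
    (hem : HasDerivWithinAt W.energy em (Iio a) a) (hep : HasDerivWithinAt W.energy ep (Ioi a) a) :
    2 * c * D' ≤ em - ep := by
  obtain ⟨hP, hM⟩ := hasDerivWithinAt_profile_of_entering_lag ha hu2 hus hR hD
  have h1 : -Vr / a ≤ em := neg_div_le_of_hasDerivWithinAt_energy_Iio ha hcov hu hP hem
  have h2 : ep ≤ -(Vr + c * (2 * a * D')) / a :=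
    le_neg_div_of_hasDerivWithinAt_energy_Ioi ha hcov hu hM hep
  have e : -(Vr + c * (2 * a * D')) / a = -Vr / a - 2 * c * D' := by
    field_simp
    ring
  rw [e] at h2
  linarith

/-- **A positive atom at an entering lag with `D' > 0` forces a corner of the bottom.**
[folklore: Kato VII §6.5 + PF §14.2] -/
theorem not_differentiableAt_energy_of_entering_lag {a : ℝ} {u : ℝ → ℂ} (ha : 0 < a)
    (hcov : W.DilationCovariantAt a) (hu : W.IsGround a u) (hu2 : MemLp u 2)
    (hus : ∀ x, a ≤ |x| → u x = 0) {c Vr D' : ℝ}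
    (hR : HasDerivAt (fun η ↦ W.profile u η - c * weilIncrement (weilDilate η u) (2 * a)) Vr 0)
    (hD : HasDerivWithinAt (weilIncrement u) D' (Iio (2 * a)) (2 * a)) (hpos : 0 < c * D') :
    ¬ DifferentiableAt ℝ W.energy a := by
  intro hd
  have h := corner_gap ha hcov hu hu2 hus hR hD hd.hasDerivAt.hasDerivWithinAt
    hd.hasDerivAt.hasDerivWithinAt
  linarith

end WindowForm

/-! ## §3 Instances: every real weight table, and ζ -/

/-- **The corner for the windowed form of every real weight table** (`tableWindowForm A w`, window
`a ≤ A`; the natural coefficient at `2a = log n₀` is `c = w n₀`, but `c` is free: the hypothesis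
`hR` says which regular part is differentiable). [folklore: Kato VII §6.5 + PF §14.2] -/
theorem corner_tableEnergy_of_entering_lag {A a : ℝ} (w : ℕ → ℝ) {u : ℝ → ℂ} (haA : a ≤ A)
    (hu : (tableWindowForm A w).IsGround a u) {c Vr D' : ℝ}
    (hR : HasDerivAt (fun η ↦ tableClosedForm (2 * A) w (weilDilate η u) -
      c * weilIncrement (weilDilate η u) (2 * a)) Vr 0)
    (hD : HasDerivWithinAt (weilIncrement u) D' (Iio (2 * a)) (2 * a)) :
    (∀ s : ℝ, s < -Vr / a → ∀ᶠ b in 𝓝[<] a, s < slope (tableEnergy w) a b) ∧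
      (∀ s : ℝ, -Vr / a - 2 * c * D' < s → ∀ᶠ b in 𝓝[>] a, slope (tableEnergy w) a b < s) := by
  have hadm : weilAdm A a u := hu.1
  obtain ⟨ha, -, hu2, hus, -, -⟩ := hadm
  exact WindowForm.corner_of_entering_lag (W := tableWindowForm A w) ha
    (tableWindowForm_dilationCovariantAt w haA) hu hu2 hus hR hD

/-- The corner gap for every real weight table: one-sided derivatives `e₋, e₊` of `tableEnergy w`
at the entering window satisfy `e₋ − e₊ ≥ 2c·D'`. [folklore: Kato VII §6.5 + PF §14.2] -/
theorem corner_gap_tableEnergy {A a : ℝ} (w : ℕ → ℝ) {u : ℝ → ℂ} (haA : a ≤ A)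
    (hu : (tableWindowForm A w).IsGround a u) {c Vr D' : ℝ}
    (hR : HasDerivAt (fun η ↦ tableClosedForm (2 * A) w (weilDilate η u) -
      c * weilIncrement (weilDilate η u) (2 * a)) Vr 0)
    (hD : HasDerivWithinAt (weilIncrement u) D' (Iio (2 * a)) (2 * a)) {em ep : ℝ}
    (hem : HasDerivWithinAt (tableEnergy w) em (Iio a) a)
    (hep : HasDerivWithinAt (tableEnergy w) ep (Ioi a) a) : 2 * c * D' ≤ em - ep := by
  have hadm : weilAdm A a u := hu.1
  obtain ⟨ha, -, hu2, hus, -, -⟩ := hadm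
  exact WindowForm.corner_gap (W := tableWindowForm A w) ha
    (tableWindowForm_dilationCovariantAt w haA) hu hu2 hus hR hD hem hep

/-- **The corner for ζ's bottom `weilGroundEnergy`** at an entering window, for a Weil ground
state `u` of the window `a` (through its open-window truncation `ũ = weilTrunc a u`, which vanishes
at every `|x| ≥ a`): hypotheses = differentiability of the regular part of the dilation profile of
`ũ` and a left lag-derivative `D'` of `t ↦ D_t(ũ)` at the diameter. [folklore: Kato VII §6.5 + PF §14.2] -/
theorem corner_weilGroundEnergy_of_entering_lag {a : ℝ} {u : ℝ → ℂ} (hu : IsWeilGroundState a u)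
    {c Vr D' : ℝ}
    (hR : HasDerivAt (fun η ↦ weilDilationProfile a u η -
      c * weilIncrement (weilDilate η (weilTrunc a u)) (2 * a)) Vr 0)
    (hD : HasDerivWithinAt (weilIncrement (weilTrunc a u)) D' (Iio (2 * a)) (2 * a)) :
    (∀ s : ℝ, s < -Vr / a → ∀ᶠ b in 𝓝[<] a, s < slope weilGroundEnergy a b) ∧
      (∀ s : ℝ, -Vr / a - 2 * c * D' < s → ∀ᶠ b in 𝓝[>] a, slope weilGroundEnergy a b < s) := by
  have ha : 0 < a := hu.pos
  have hg := isGround_weilWindowForm hu le_rfl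
  have hu2 : MemLp (weilTrunc a u) 2 := (isWeilGroundState_weilTrunc hu).memLp
  have hus : ∀ x, a ≤ |x| → weilTrunc a u x = 0 := fun x hx ↦ weilTrunc_eq_zero u hx
  rw [← weilWindowForm_profile] at hR
  exact WindowForm.corner_of_entering_lag (W := weilWindowForm a) ha
    (weilWindowForm_dilationCovariantAt le_rfl) hg hu2 hus hR hD

/-- The corner gap for ζ: one-sided derivatives `e₋, e₊` of `weilGroundEnergy` at the entering
window satisfy `e₋ − e₊ ≥ 2c·D'`; in particular `c·D' > 0` forces a corner.
[folklore: Kato VII §6.5 + PF §14.2] -/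
theorem corner_gap_weilGroundEnergy {a : ℝ} {u : ℝ → ℂ} (hu : IsWeilGroundState a u)
    {c Vr D' : ℝ}
    (hR : HasDerivAt (fun η ↦ weilDilationProfile a u η -
      c * weilIncrement (weilDilate η (weilTrunc a u)) (2 * a)) Vr 0)
    (hD : HasDerivWithinAt (weilIncrement (weilTrunc a u)) D' (Iio (2 * a)) (2 * a)) {em ep : ℝ}
    (hem : HasDerivWithinAt weilGroundEnergy em (Iio a) a)
    (hep : HasDerivWithinAt weilGroundEnergy ep (Ioi a) a) : 2 * c * D' ≤ em - ep := by
  have ha : 0 < a := hu.pos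
  have hg := isGround_weilWindowForm hu le_rfl
  have hu2 : MemLp (weilTrunc a u) 2 := (isWeilGroundState_weilTrunc hu).memLp
  have hus : ∀ x, a ≤ |x| → weilTrunc a u x = 0 := fun x hx ↦ weilTrunc_eq_zero u hx
  rw [← weilWindowForm_profile] at hR
  exact WindowForm.corner_gap (W := weilWindowForm a) ha (weilWindowForm_dilationCovariantAt le_rfl)
    hg hu2 hus hR hD hem hep

end Summit.RiemannHypothesis.RiemannHypothesis.Theorems.PfPersistence

end
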